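import Literature.AnabelianGeometry.AbsoluteAnabelian.AbsTopICharacterRankAdditive
import Literature.AnabelianGeometry.AbsoluteAnabelian.AbsTopICuspidalDecompositionSubProofs
import HarnessLib

/-!
# [AbsTopI] Lemma 4.5 (iii): the weights realised by `(H^{ab} ⊗ ℚ_l) ⊕ ℚ_l` are `{0} ∪ w_l(H^{ab} ⊗ ℚ_l)`

Proof-only companion of `AbsTopICharacterRank.lean` (S. Mochizuki, *Topics in Absolute Anabelian
Geometry I: Generalities* [MochizukiAbsTopI2012], Lemma 4.5 (iii), kurims manuscript p. 54:
"`τ(M(χ•⁻¹)) ≠ 0` for some subquotient `G`-module `M` of `(H^{ab} ⊗ ℚ_l) ⊕ ℚ_l` [where the final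
direct summand `ℚ_l` is equipped with the trivial `G`-action]"; [CombGC] Prop. 2.4 (vii) p. 20:
"the subset `{0} ∪ w_l(M_{G′} ⊗ ℤ_l) ⊆ ℚ`"), cell abc-iut, block F, seat abc-iut-f-062.
The trunk's predicate `RealisedWeight χ^{cyclo} V w` (FACT-LIST F-0225) quantifies over the twisted
module `(V ⊕ K)(χ⁻¹)`; sub-node A7's docstring reads its extension as "`{0} ∪ w_l(V)`".  This file
PROVES that reading:

* sub- and quotient representations of a stable submodule EXIST as representations intertwined with
  `ρ` (`exists_subrepresentation`, `exists_quotientRepresentation` — so the additivity theorem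
  `quasiTrivialRank_eq_add_of_exact` applies to every stable `N`);
* `quasiTrivialRank_twist_withTrivial`: **`τ((V ⊕ K)(χ)) = τ(V(χ)) + τ(K(χ))`**;
* `quasiTrivialRank_twist_one`: the line `K(ψ)` has `τ = 1` if `ψ` is trivial on an open subgroup
  of finite index and `τ = 0` otherwise;
* `realisedWeight_iff`: `w` is realised by `V ⊕ K` iff some `ℚ`-cyclotomic `χ` of weight `w` has
  `τ(V(χ⁻¹)) ≠ 0` OR is trivial on an open subgroup of finite index;
* `realisedWeight_iff_zero_or` — **print's `{0} ∪ w_l(V)`**: if `χ^{cyclo}` is non-degenerate (no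
  nonzero power is trivial on an open subgroup of finite index — automatic for the cyclotomic
  character of an MLF or NF), then `w` is realised iff `w = 0` or `τ(V(χ⁻¹)) ≠ 0` for some
  `ℚ`-cyclotomic `χ` of weight `w`.
No new definitions.  HONEST FRAMING: refereed pre-IUT anabelian geometry; nothing here bears on
[IUTchIII] Cor. 3.12.
-/

noncomputable section

open scoped Classical

namespace Literature.AnabelianGeometry.AbsoluteAnabelian.AbsTopI

universe u v w w'

section WithTrivial

variable {G : Type u} [Group G] [TopologicalSpace G]
variable {K : Type v} [Field K] {M : Type w} [AddCommGroup M] [Module K M]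
variable {V : Type w'} [AddCommGroup V] [Module K V]

/-! ### Sub- and quotient representations of a stable submodule -/

omit [TopologicalSpace G] in
/-- A stable submodule is mapped ONTO itself by every `ρ(g)`. [cite: MochizukiAbsTopI2012, Lemma 4.5 (ii) p.54] -/
theorem IsStable.map_eq {ρ : G →* (M ≃ₗ[K] M)} {N : Submodule K M} (hN : IsStable ρ N) (g : G) :
    N.map (ρ g : M →ₗ[K] M) = N := by
  apply le_antisymm
  · rintro _ ⟨m, hm, rfl⟩
    exact hN g m hm
  · intro m hm
    refine ⟨ρ g⁻¹ m, hN g⁻¹ m hm, ?_⟩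
    show ρ g (ρ g⁻¹ m) = m
    rw [← LinearEquiv.mul_apply, ← map_mul, mul_inv_cancel, map_one]
    rfl

omit [TopologicalSpace G] in
/-- The **subrepresentation** on a stable submodule `N` exists: a representation `ρN` of `G` on `N`
with `ρN(g) n = ρ(g) n`. [cite: MochizukiAbsTopI2012, Lemma 4.5 (ii) p.54] -/
theorem exists_subrepresentation (ρ : G →* (M ≃ₗ[K] M)) {N : Submodule K M} (hN : IsStable ρ N) :
    ∃ ρN : G →* (↥N ≃ₗ[K] ↥N), ∀ (g : G) (n : ↥N), ((ρN g n : ↥N) : M) = ρ g n := by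
  let e : G → (↥N ≃ₗ[K] ↥N) := fun g => LinearEquiv.ofSubmodules (ρ g) N N (hN.map_eq g)
  have he : ∀ (g : G) (n : ↥N), ((e g n : ↥N) : M) = ρ g n := fun g n =>
    LinearEquiv.ofSubmodules_apply _ _ _
  refine ⟨{ toFun := e, map_one' := ?_, map_mul' := ?_ }, he⟩
  · apply LinearEquiv.ext
    intro n
    apply Subtype.ext
    rw [he, map_one]
    rfl
  · intro g h
    apply LinearEquiv.ext
    intro n
    apply Subtype.ext
    rw [he, LinearEquiv.mul_apply, he, he, map_mul, LinearEquiv.mul_apply]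

omit [TopologicalSpace G] in
/-- The **quotient representation** on `M/N` for a stable submodule `N` exists: a representation
`ρQ` of `G` on `M/N` with `ρQ(g) [m] = [ρ(g) m]`. [cite: MochizukiAbsTopI2012, Lemma 4.5 (ii) p.54] -/
theorem exists_quotientRepresentation (ρ : G →* (M ≃ₗ[K] M)) {N : Submodule K M}
    (hN : IsStable ρ N) :
    ∃ ρQ : G →* ((M ⧸ N) ≃ₗ[K] (M ⧸ N)), ∀ (g : G) (m : M), ρQ g (N.mkQ m) = N.mkQ (ρ g m) := by
  let e : G → ((M ⧸ N) ≃ₗ[K] (M ⧸ N)) := fun g => Submodule.Quotient.equiv N N (ρ g) (hN.map_eq g)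
  have he : ∀ (g : G) (m : M), e g (N.mkQ m) = N.mkQ (ρ g m) := fun g m => rfl
  refine ⟨{ toFun := e, map_one' := ?_, map_mul' := ?_ }, he⟩
  · apply LinearEquiv.ext
    intro x
    obtain ⟨m, rfl⟩ := N.mkQ_surjective x
    rw [he, map_one]
    rfl
  · intro g h
    apply LinearEquiv.ext
    intro x
    obtain ⟨m, rfl⟩ := N.mkQ_surjective x
    rw [he, LinearEquiv.mul_apply, he, he, map_mul, LinearEquiv.mul_apply]

/-- Additivity of `τ` along ANY stable submodule (the sub/quotient representations being supplied by
the two existence theorems): `τ(M) = τ(N) + τ(M/N)` — packaged as an existential over the two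
representations. [cite: MochizukiAbsTopI2012, Lemma 4.5 (ii) p.54] [cite: MochizukiCombGC2007, Def. 2.3 (i) p.18] -/
theorem exists_quasiTrivialRank_eq_add [FiniteDimensional K M] (ρ : G →* (M ≃ₗ[K] M))
    {N : Submodule K M} (hN : IsStable ρ N) :
    ∃ (ρN : G →* (↥N ≃ₗ[K] ↥N)) (ρQ : G →* ((M ⧸ N) ≃ₗ[K] (M ⧸ N))),
      (∀ (g : G) (n : ↥N), ((ρN g n : ↥N) : M) = ρ g n) ∧
      (∀ (g : G) (m : M), ρQ g (N.mkQ m) = N.mkQ (ρ g m)) ∧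
      quasiTrivialRank ρ = quasiTrivialRank ρN + quasiTrivialRank ρQ := by
  obtain ⟨ρN, hρN⟩ := exists_subrepresentation ρ hN
  obtain ⟨ρQ, hρQ⟩ := exists_quotientRepresentation ρ hN
  exact ⟨ρN, ρQ, hρN, hρQ, quasiTrivialRank_eq_add_of_exact ρ hN ρN hρN ρQ hρQ⟩

/-! ### `τ((V ⊕ K)(χ)) = τ(V(χ)) + τ(K(χ))` -/

omit [TopologicalSpace G] in
/-- The twisted action on `V ⊕ K`, evaluated. [cite: MochizukiAbsTopI2012, Lemma 4.5 (iii) p.54] -/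
theorem twist_withTrivial_apply (ρV : G →* (V ≃ₗ[K] V)) (χ : G →* Kˣ) (g : G) (x : V × K) :
    twist (withTrivial ρV) χ g x = ((χ g : K) • ρV g x.1, (χ g : K) • x.2) := by
  rw [twist_apply]
  rfl

/-- **`τ((V ⊕ K)(χ)) = τ(V(χ)) + τ(K(χ))`**: the quasi-trivial rank of the twisted module
"`(H^{ab} ⊗ ℚ_l) ⊕ ℚ_l`" of [AbsTopI] Lemma 4.5 (iii) splits over its two summands (additivity of `τ`
along the stable submodule `V ⊕ 0`, whose sub- resp. quotient representation is isomorphic to `V(χ)`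
resp. the line `K(χ)`). [cite: MochizukiAbsTopI2012, Lemma 4.5 (iii) p.54] -/
theorem quasiTrivialRank_twist_withTrivial [FiniteDimensional K V] (ρV : G →* (V ≃ₗ[K] V))
    (χ : G →* Kˣ) :
    quasiTrivialRank (twist (withTrivial ρV) χ) =
      quasiTrivialRank (twist ρV χ) + quasiTrivialRank (twist (1 : G →* (K ≃ₗ[K] K)) χ) := by
  set ρ' := twist (withTrivial ρV) χ with hρ'def
  let N : Submodule K (V × K) := LinearMap.range (LinearMap.inl K V K)
  have hN : IsStable ρ' N := by
    rintro g _ ⟨v, rfl⟩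
    exact ⟨(χ g : K) • ρV g v, by rw [hρ'def, twist_withTrivial_apply]; simp⟩
  obtain ⟨ρN, ρQ, hρN, hρQ, hadd⟩ := exists_quasiTrivialRank_eq_add ρ' hN
  rw [hadd]
  congr 1
  · -- `V(χ) ≅` the subrepresentation on `V ⊕ 0`
    symm
    let eV : V ≃ₗ[K] ↥N := LinearEquiv.ofInjective (LinearMap.inl K V K) LinearMap.inl_injective
    have h1 : ∀ v : V, ((eV v : ↥N) : V × K) = (v, 0) := fun v => rfl
    refine quasiTrivialRank_eq_of_equivariant eV fun g v => ?_
    apply Subtype.ext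
    rw [hρN, h1, h1, hρ'def, twist_withTrivial_apply, twist_apply]
    simp
  · -- `K(χ) ≅` the quotient representation on `(V ⊕ K)/(V ⊕ 0)`
    symm
    have hinj : Function.Injective (N.mkQ.comp (LinearMap.inr K V K)) := by
      intro c₁ c₂ h
      have h' : (LinearMap.inr K V K c₁ - LinearMap.inr K V K c₂) ∈ N := (Submodule.Quotient.eq N).1 h
      obtain ⟨v, hv⟩ := h'
      have := congrArg Prod.snd hv
      simp at this
      exact sub_eq_zero.1 this.symm
    have hsurj : Function.Surjective (N.mkQ.comp (LinearMap.inr K V K)) := by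
      intro x
      obtain ⟨⟨v, c⟩, rfl⟩ := N.mkQ_surjective x
      refine ⟨c, (Submodule.Quotient.eq N).2 ⟨-v, ?_⟩⟩
      simp
    let eK : K ≃ₗ[K] ((V × K) ⧸ N) := LinearEquiv.ofBijective _ ⟨hinj, hsurj⟩
    have h2 : ∀ c : K, eK c = N.mkQ ((0 : V), c) := fun c => rfl
    refine quasiTrivialRank_eq_of_equivariant eK fun g c => ?_
    rw [h2, h2, hρQ, hρ'def, twist_withTrivial_apply, twist_apply]
    simp

/-! ### The line `K(ψ)` -/

/-- The whole line `K(ψ)` is a quasi-trivial step iff `ψ` is trivial on an open subgroup of finite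
index. [cite: MochizukiAbsTopI2012, Lemma 4.5 (ii) p.54] -/
theorem isQuasiTrivialStep_top_bot_twist_one_iff (ψ : G →* Kˣ) :
    IsQuasiTrivialStep (twist (1 : G →* (K ≃ₗ[K] K)) ψ) ⊤ ⊥ ↔
      ∃ U : Subgroup G, IsOpen (U : Set G) ∧ U.FiniteIndex ∧ ∀ g ∈ U, ψ g = 1 := by
  constructor
  · rintro ⟨U, hU, hfi, hact⟩
    refine ⟨U, hU, hfi, fun g hg => ?_⟩
    have h := hact g hg 1 Submodule.mem_top
    rw [Submodule.mem_bot, twist_apply, MonoidHom.one_apply, LinearEquiv.coe_one, id_eq, smul_eq_mul,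
      mul_one, sub_eq_zero] at h
    exact Units.val_eq_one.1 h
  · rintro ⟨U, hU, hfi, hact⟩
    refine ⟨U, hU, hfi, fun g hg c _ => ?_⟩
    rw [Submodule.mem_bot, twist_apply, hact g hg, MonoidHom.one_apply, LinearEquiv.coe_one, id_eq,
      Units.val_one, one_smul, sub_self]

/-- **`τ(K(ψ))`**: the twisted line has quasi-trivial rank `1` if `ψ` is trivial on an open subgroup
of finite index, and `0` otherwise (its only filtration step `K ⊇ 0` has no nontrivial
subquotients, so it is admissible and computes `τ`). [cite: MochizukiAbsTopI2012, Lemma 4.5 (ii) p.54] -/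
theorem quasiTrivialRank_twist_one (ψ : G →* Kˣ) :
    quasiTrivialRank (twist (1 : G →* (K ≃ₗ[K] K)) ψ) =
      if ∃ U : Subgroup G, IsOpen (U : Set G) ∧ U.FiniteIndex ∧ ∀ g ∈ U, ψ g = 1 then 1 else 0 := by
  set ρ := twist (1 : G →* (K ≃ₗ[K] K)) ψ with hρ
  -- the one-step filtration `K ⊇ 0` is admissible: no submodule strictly in between
  have hadm : (StableChain.trivial ρ).IsAdmissible := by
    rw [StableChain.isAdmissible_trivial_iff]
    right
    refine ⟨bot_lt_top, fun P _ _ _ => ?_⟩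
    exact Ideal.eq_bot_or_top P
  rw [← hadm.qtDim_eq_quasiTrivialRank]
  have h0 : (StableChain.trivial ρ).term 0 = ⊤ := rfl
  have h1 : (StableChain.trivial ρ).term (0 + 1) = ⊥ := rfl
  unfold StableChain.qtDim
  rw [show (StableChain.trivial ρ).length = 1 from rfl, Finset.range_one, Finset.sum_singleton, h0, h1,
    finrank_top, finrank_bot, Module.finrank_self]
  by_cases h : ∃ U : Subgroup G, IsOpen (U : Set G) ∧ U.FiniteIndex ∧ ∀ g ∈ U, ψ g = 1
  · rw [if_pos h, if_pos ((isQuasiTrivialStep_top_bot_twist_one_iff ψ).2 h)]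
  · rw [if_neg h, if_neg (fun h' => h ((isQuasiTrivialStep_top_bot_twist_one_iff ψ).1 h'))]

/-! ### F-0225 `RealisedWeight` decomposed: `{0} ∪ w_l(V)` -/

/-- **The weights realised by `V ⊕ K`, decomposed**: `w` is realised iff some `ℚ`-cyclotomic `χ` of
weight `w` has `τ(V(χ⁻¹)) ≠ 0` (i.e. `w ∈ w_l(V)`) OR is trivial on an open subgroup of finite index
(the trivial summand `ℚ_l` realises it). [cite: MochizukiAbsTopI2012, Lemma 4.5 (iii) p.54]
[cite: MochizukiCombGC2007, Prop. 2.4 (vii) p.20] -/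
theorem realisedWeight_iff [FiniteDimensional K V] (χcyclo : G →* Kˣ) (ρV : G →* (V ≃ₗ[K] V))
    (w : ℚ) :
    RealisedWeight χcyclo ρV w ↔ ∃ χ : G →* Kˣ, IsQCyclotomicOfWeightK χcyclo χ w ∧
      (quasiTrivialRank (twist ρV χ⁻¹) ≠ 0 ∨
        ∃ U : Subgroup G, IsOpen (U : Set G) ∧ U.FiniteIndex ∧ ∀ g ∈ U, χ g = 1) := by
  have key : ∀ χ : G →* Kˣ, quasiTrivialRank (twist (withTrivial ρV) χ⁻¹) ≠ 0 ↔
      (quasiTrivialRank (twist ρV χ⁻¹) ≠ 0 ∨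
        ∃ U : Subgroup G, IsOpen (U : Set G) ∧ U.FiniteIndex ∧ ∀ g ∈ U, χ g = 1) := by
    intro χ
    have hline : (∃ U : Subgroup G, IsOpen (U : Set G) ∧ U.FiniteIndex ∧ ∀ g ∈ U, χ⁻¹ g = 1) ↔
        ∃ U : Subgroup G, IsOpen (U : Set G) ∧ U.FiniteIndex ∧ ∀ g ∈ U, χ g = 1 := by
      simp only [MonoidHom.inv_apply, inv_eq_one]
    rw [quasiTrivialRank_twist_withTrivial, quasiTrivialRank_twist_one]
    by_cases h : ∃ U : Subgroup G, IsOpen (U : Set G) ∧ U.FiniteIndex ∧ ∀ g ∈ U, χ⁻¹ g = 1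
    · rw [if_pos h]
      have h' : ∃ U : Subgroup G, IsOpen (U : Set G) ∧ U.FiniteIndex ∧ ∀ g ∈ U, χ g = 1 := hline.1 h
      constructor
      · intro _; exact Or.inr h'
      · intro _; omega
    · rw [if_neg h, add_zero]
      have h' : ¬ ∃ U : Subgroup G, IsOpen (U : Set G) ∧ U.FiniteIndex ∧ ∀ g ∈ U, χ g = 1 :=
        fun h'' => h (hline.2 h'')
      constructor
      · intro hne; exact Or.inl hne
      · rintro (hne | h'')
        · exact hne
        · exact absurd h'' h'
  unfold RealisedWeight
  constructor
  · rintro ⟨χ, hχ, hne⟩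
    exact ⟨χ, hχ, (key χ).1 hne⟩
  · rintro ⟨χ, hχ, h⟩
    exact ⟨χ, hχ, (key χ).2 h⟩

/-- **[AbsTopI] Lemma 4.5 (iii) / [CombGC] Prop. 2.4 (vii): the weights realised by
`(H^{ab} ⊗ ℚ_l) ⊕ ℚ_l` are exactly `{0} ∪ w_l(H^{ab} ⊗ ℚ_l)`** — for a NON-DEGENERATE cyclotomic
character (no nonzero power of `χ^{cyclo}` is trivial on an open subgroup of finite index; automatic
for the cyclotomic character of an MLF or NF, which has infinite order on every open subgroup):
`w` is realised iff `w = 0` or `τ(V(χ⁻¹)) ≠ 0` for some `ℚ`-cyclotomic `χ` of weight `w`.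
[cite: MochizukiAbsTopI2012, Lemma 4.5 (iii) p.54] [cite: MochizukiCombGC2007, Prop. 2.4 (vii) p.20] -/
theorem realisedWeight_iff_zero_or [FiniteDimensional K V] (χcyclo : G →* Kˣ)
    (hcyc : ∀ U : Subgroup G, IsOpen (U : Set G) → U.FiniteIndex →
      ∀ a : ℤ, a ≠ 0 → ∃ g ∈ U, χcyclo g ^ a ≠ 1)
    (ρV : G →* (V ≃ₗ[K] V)) (w : ℚ) :
    RealisedWeight χcyclo ρV w ↔
      w = 0 ∨ ∃ χ : G →* Kˣ, IsQCyclotomicOfWeightK χcyclo χ w ∧ quasiTrivialRank (twist ρV χ⁻¹) ≠ 0 := by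
  rw [realisedWeight_iff]
  constructor
  · rintro ⟨χ, hχ, h | ⟨U, hU, hfi, hact⟩⟩
    · exact Or.inr ⟨χ, hχ, h⟩
    · -- a `ℚ`-cyclotomic character trivial on `U` has weight `0`, by non-degeneracy of `χ^{cyclo}`
      left
      obtain ⟨a, b, hb, hab, hw⟩ := hχ
      have ha : a = 0 := by
        by_contra ha
        obtain ⟨g, hg, hne⟩ := hcyc U hU hfi a ha
        exact hne (by rw [← hab g, hact g hg, one_zpow])
      rw [hw, ha]
      simp
  · rintro (rfl | ⟨χ, hχ, h⟩)
    · have h0 := zeroWeightRealised_holds χcyclo ρV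
      exact (realisedWeight_iff χcyclo ρV 0).1 h0
    · exact ⟨χ, hχ, Or.inl h⟩

end WithTrivial

end Literature.AnabelianGeometry.AbsoluteAnabelian.AbsTopI

end
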